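import Literature.MathematicalPhysics.QuantumManyBody.BoseGasSlabLocalization
import Literature.MathematicalPhysics.QuantumManyBody.BoseGasMixedCellFloor
import HarnessLib

/-!
# Bracketing a Dirichlet near-wall layer: localisation plus mixed Dirichlet/Neumann cells

Topic `Literature/MathematicalPhysics/QuantumManyBody`, namespace `…BoseGas`; assembles
`BoseGasSlabLocalization.lean` (the IMS two-piece localisation `Φ ↦ Φ W_σ`,
`W_σ = ∏ⱼ c_{σ j}(x_{j,a})`, across a ramp `[h₀, h₀ + δ]` in the coordinate direction `a`) and
`BoseGasMixedCellFloor.lean` (the mixed floor on the region `R(lam)` of a labelling `lam` and the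
partition `∫ F = ∑_{lam ↦ σ} ∫_{R(lam)} F`) into the form used by slab estimates for a Dirichlet
trial state `Φ` of the box `Λ_L`, `L = Kℓ`, with the grid cells of side `ℓ`:

* integrated localisation facts: `sum_lintegral_energyDensity_loc_le`
  (`∑_σ 𝓔[ΦW_σ] ≤ 𝓔[Φ] + N D² ∫|Φ|²`), `sum_lintegral_ennnormSq_loc` (`∑_σ ∫|ΦW_σ|² = ∫|Φ|²`),
  `sum_indicator_slab_le_sum_card_mul` / `sum_setLIntegral_slab_le_sum_card_mul` (above the ramp
  only the upper pieces count: `∑ⱼ ∫_{x_{j,a}>t₀}|Φ|² ≤ ∑_σ #{σ=1} ∫|ΦW_σ|²`);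
* with the WEIGHTS `w(σ, lam) = ∫_{R(lam)} |ΦW_σ|²` of the labellings `lam` inducing the split `σ`:
  `sum_sum_weight_eq_one` (`∑_σ ∑_{lam ↦ σ} w = 1`),
  `sum_sum_floor_mul_weight_le` (`∑_σ ∑_{lam ↦ σ} (E₀^D(n_bulk, L) + ∑_c E₀^Neu(n_c, ℓ)) w ≤ ⟨Φ,HΦ⟩ + N D²`:
  the bulk piece is an unconstrained Dirichlet group, the upper piece is bracketed into Neumann
  cells — no artificial boundary condition is ever imposed), and
  `slab_le_sum_card_mul_sum_weight` (`∑ⱼ ∫_{x_{j,a}>t₀}|Φ|² ≤ ∑_σ #{σ=1} ∑_{lam ↦ σ} w`);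
* the top layer: a labelling of positive weight puts every upper particle into one of the `≤ K²`
  cells of the top layer (`topLayer_of_weight_ne_zero`, `card_topCells_le`,
  `sum_card_topCells_eq_card`), when the upper profile vanishes below `L - ℓ`.

No definitions. [LSSY2005, (2.52)–(2.53); CFKS1987, Thm. 3.2]

## References

* [LSSY2005] E. H. Lieb, R. Seiringer, J. P. Solovej, J. Yngvason, *The Mathematics of the Bose
  Gas and its Condensation* (2005), (2.52)–(2.53).
* [CFKS1987] H. L. Cycon, R. G. Froese, W. Kirsch, B. Simon, *Schrödinger Operators*, Springer
  1987, Thm. 3.2 (IMS localization formula).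
-/

noncomputable section

namespace Literature.MathematicalPhysics.QuantumManyBody.BoseGas

open _root_.MeasureTheory _root_.Filter _root_.Set
open scoped ENNReal NNReal Topology BigOperators

/-! ### Integrated localisation facts -/

section Integrated

variable {N : ℕ}

/-- **The energies of the pieces exceed the energy by at most the localisation error**:
`∑_σ ∫ (|∇(ΦW_σ)|² + ∑v |ΦW_σ|²) ≤ ∫ (|∇Φ|² + ∑v|Φ|²) + N D² ∫|Φ|²`. [folklore] -/
theorem sum_lintegral_energyDensity_loc_le {c : Fin 2 → ℝ → ℝ} (hc : ∀ b, ContDiff ℝ 1 (c b))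
    (hsq : ∀ t, ∑ b, c b t ^ 2 = 1) (horth : ∀ t, ∑ b, c b t * deriv (c b) t = 0) {D : ℝ}
    (hD : ∀ t, ∑ b, deriv (c b) t ^ 2 ≤ D ^ 2) (a : Fin 3) {v : ℝ → ℝ≥0∞} (hv : Measurable v)
    {Φ : Config N → ℂ} (hΦ : ContDiff ℝ 1 Φ) :
    ∑ σ : Fin N → Fin 2, ∫⁻ X, kineticDensity (fun X : Config N => Φ X * ((∏ j, c (σ j) (X j a) : ℝ) : ℂ)) X +
        interaction v X * ((‖Φ X * ((∏ j, c (σ j) (X j a) : ℝ) : ℂ)‖₊ : ℝ≥0∞)) ^ 2 ≤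
      (∫⁻ X, kineticDensity Φ X + interaction v X * ((‖Φ X‖₊ : ℝ≥0∞)) ^ 2) +
        N * ENNReal.ofReal (D ^ 2) * ∫⁻ X, ((‖Φ X‖₊ : ℝ≥0∞)) ^ 2 := by
  have hmeas : ∀ σ : Fin N → Fin 2, Measurable fun X =>
      kineticDensity (fun X : Config N => Φ X * ((∏ j, c (σ j) (X j a) : ℝ) : ℂ)) X +
        interaction v X * ((‖Φ X * ((∏ j, c (σ j) (X j a) : ℝ) : ℂ)‖₊ : ℝ≥0∞)) ^ 2 := fun σ =>
    (measurable_kineticDensity (contDiff_loc hc a σ hΦ)).add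
      ((measurable_interaction hv).mul (measurable_normSq (contDiff_loc hc a σ hΦ).continuous))
  have hA : Measurable fun X : Config N =>
      kineticDensity Φ X + interaction v X * ((‖Φ X‖₊ : ℝ≥0∞)) ^ 2 :=
    (measurable_kineticDensity hΦ).add ((measurable_interaction hv).mul
      (measurable_normSq hΦ.continuous))
  rw [← lintegral_finsetSum Finset.univ fun σ _ => hmeas σ,
    ← lintegral_const_mul _ (measurable_normSq hΦ.continuous), ← lintegral_add_left hA]
  refine lintegral_mono fun X => ?_
  rw [Finset.sum_add_distrib, ← Finset.mul_sum, sum_ennnormSq_loc hsq a Φ X]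
  calc _ ≤ (kineticDensity Φ X + N * ENNReal.ofReal (D ^ 2) * ((‖Φ X‖₊ : ℝ≥0∞)) ^ 2) +
        interaction v X * ((‖Φ X‖₊ : ℝ≥0∞)) ^ 2 :=
        add_le_add (sum_kineticDensity_loc_le hc hsq horth hD a hΦ X) le_rfl
    _ = _ := by ring

/-- **The masses of the pieces add up** (integrated): `∑_σ ∫|ΦW_σ|² = ∫|Φ|²`. [folklore] -/
theorem sum_lintegral_ennnormSq_loc {c : Fin 2 → ℝ → ℝ} (hc : ∀ b, ContDiff ℝ 1 (c b))
    (hsq : ∀ t, ∑ b, c b t ^ 2 = 1) (a : Fin 3) {Φ : Config N → ℂ} (hΦ : ContDiff ℝ 1 Φ) :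
    ∑ σ : Fin N → Fin 2, ∫⁻ X, ((‖Φ X * ((∏ j, c (σ j) (X j a) : ℝ) : ℂ)‖₊ : ℝ≥0∞)) ^ 2 =
      ∫⁻ X, ((‖Φ X‖₊ : ℝ≥0∞)) ^ 2 := by
  rw [← lintegral_finsetSum Finset.univ fun σ _ =>
    measurable_normSq (contDiff_loc hc a σ hΦ).continuous]
  exact lintegral_congr fun X => sum_ennnormSq_loc hsq a Φ X

/-- **The slab count**: above the ramp only the upper pieces are present, so for `t₀ ≥ h₀ + δ`,
`∑ⱼ 1_{x_{j,a} > t₀} |Φ|² ≤ ∑_σ #{σ = 1} |ΦW_σ|²` pointwise. [folklore] -/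
theorem sum_indicator_slab_le_sum_card_mul {c : Fin 2 → ℝ → ℝ} (hsq : ∀ t, ∑ b, c b t ^ 2 = 1)
    {h₀ δ : ℝ} (hc0 : ∀ t, h₀ + δ ≤ t → c 0 t = 0) (a : Fin 3) (Φ : Config N → ℂ) {t₀ : ℝ}
    (ht₀ : h₀ + δ ≤ t₀) (X : Config N) :
    ∑ j : Fin N, {X : Config N | t₀ < X j a}.indicator (fun X => ((‖Φ X‖₊ : ℝ≥0∞)) ^ 2) X ≤
      ∑ σ : Fin N → Fin 2, ((Finset.univ.filter fun j => σ j = 1).card : ℝ≥0∞) *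
        ((‖Φ X * ((∏ j, c (σ j) (X j a) : ℝ) : ℂ)‖₊ : ℝ≥0∞)) ^ 2 := by
  classical
  have hj : ∀ j : Fin N, {X : Config N | t₀ < X j a}.indicator (fun X => ((‖Φ X‖₊ : ℝ≥0∞)) ^ 2) X ≤
      ∑ σ : Fin N → Fin 2, (if σ j = 1 then 1 else 0) *
        ((‖Φ X * ((∏ j, c (σ j) (X j a) : ℝ) : ℂ)‖₊ : ℝ≥0∞)) ^ 2 := by
    intro j
    by_cases hX : t₀ < X j a
    · rw [Set.indicator_of_mem (show X ∈ {X : Config N | t₀ < X j a} from hX),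
        ← sum_ennnormSq_loc hsq a Φ X]
      refine Finset.sum_le_sum fun σ _ => ?_
      by_cases hσ : σ j = 1
      · rw [if_pos hσ, one_mul]
      · have hσ0 : σ j = 0 := by
          rcases Fin.exists_fin_two.1 ⟨σ j, rfl⟩ with h | h
          · exact h
          · exact absurd h hσ
        rw [loc_eq_zero_of_lower_ge hc0 a σ Φ hσ0 (by linarith)]
        simp
    · rw [Set.indicator_of_notMem (show X ∉ {X : Config N | t₀ < X j a} from hX)]
      exact bot_le
  refine (Finset.sum_le_sum fun j _ => hj j).trans (le_of_eq ?_)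
  rw [Finset.sum_comm]
  refine Finset.sum_congr rfl fun σ _ => ?_
  rw [← Finset.sum_mul]
  congr 1
  rw [Finset.card_filter]
  push_cast
  exact Finset.sum_congr rfl fun j _ => by split_ifs <;> simp



/-- **The slab count, integrated**: `∑ⱼ ∫_{x_{j,a} > t₀} |Φ|² ≤ ∑_σ #{σ = 1} ∫|ΦW_σ|²` for
`t₀ ≥ h₀ + δ`. [folklore] -/
theorem sum_setLIntegral_slab_le_sum_card_mul {c : Fin 2 → ℝ → ℝ} (hc : ∀ b, ContDiff ℝ 1 (c b))
    (hsq : ∀ t, ∑ b, c b t ^ 2 = 1) {h₀ δ : ℝ} (hc0 : ∀ t, h₀ + δ ≤ t → c 0 t = 0) (a : Fin 3)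
    {Φ : Config N → ℂ} (hΦ : ContDiff ℝ 1 Φ) {t₀ : ℝ} (ht₀ : h₀ + δ ≤ t₀) :
    ∑ j : Fin N, ∫⁻ X in {X : Config N | t₀ < X j a}, ((‖Φ X‖₊ : ℝ≥0∞)) ^ 2 ≤
      ∑ σ : Fin N → Fin 2, ((Finset.univ.filter fun j => σ j = 1).card : ℝ≥0∞) *
        ∫⁻ X, ((‖Φ X * ((∏ j, c (σ j) (X j a) : ℝ) : ℂ)‖₊ : ℝ≥0∞)) ^ 2 := by
  have hS : ∀ j : Fin N, MeasurableSet {X : Config N | t₀ < X j a} := fun j =>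
    measurableSet_coordWall t₀ j a
  have h1 : ∀ j : Fin N, ∫⁻ X in {X : Config N | t₀ < X j a}, ((‖Φ X‖₊ : ℝ≥0∞)) ^ 2 =
      ∫⁻ X, {X : Config N | t₀ < X j a}.indicator (fun X => ((‖Φ X‖₊ : ℝ≥0∞)) ^ 2) X := fun j =>
    (lintegral_indicator (hS j) _).symm
  simp_rw [h1]
  rw [← lintegral_finsetSum Finset.univ fun j _ => (measurable_normSq hΦ.continuous).indicator (hS j)]
  simp_rw [← lintegral_const_mul _ (measurable_normSq (contDiff_loc hc a _ hΦ).continuous)]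
  rw [← lintegral_finsetSum Finset.univ fun σ _ =>
    (measurable_normSq (contDiff_loc hc a σ hΦ).continuous).const_mul _]
  exact lintegral_mono fun X => sum_indicator_slab_le_sum_card_mul hsq hc0 a Φ ht₀ X


end Integrated

/-! ### Weights of the labellings for a Dirichlet trial state -/

section Weights

variable {N K : ℕ} {ℓ L : ℝ}

/-- **The weights add up to one**: for a Dirichlet trial state `Φ` of `Λ_L`, `L = Kℓ`,
`∑_σ ∑_{lam ↦ σ} ∫_{R(lam)} |ΦW_σ|² = ∫|Φ|² = 1`. [cite: LSSY2005, (2.52)] -/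
theorem sum_sum_weight_eq_one (hℓ : 0 < ℓ) (hK : 0 < K) (hKℓ : (K : ℝ) * ℓ = L)
    {c : Fin 2 → ℝ → ℝ} (hc : ∀ b, ContDiff ℝ 1 (c b)) (hsq : ∀ t, ∑ b, c b t ^ 2 = 1) (a : Fin 3)
    (Φ : TrialState N L) :
    ∑ σ : Fin N → Fin 2, ∑ lam ∈ Finset.univ.filter
        (fun lam : Fin N → Fin (K ^ 3 + 1) => ∀ j, lam j = Fin.last _ ↔ σ j = 0),
      ∫⁻ X in {X : Config N | ∀ j (c' : Fin (K ^ 3)), lam j = c'.castSucc →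
          X j - cellCorner K ℓ c' ∈ box ℓ},
        ((‖Φ.ψ X * ((∏ j, c (σ j) (X j a) : ℝ) : ℂ)‖₊ : ℝ≥0∞)) ^ 2 = 1 := by
  have hσ : ∀ σ : Fin N → Fin 2, ∑ lam ∈ Finset.univ.filter
        (fun lam : Fin N → Fin (K ^ 3 + 1) => ∀ j, lam j = Fin.last _ ↔ σ j = 0),
      ∫⁻ X in {X : Config N | ∀ j (c' : Fin (K ^ 3)), lam j = c'.castSucc →
          X j - cellCorner K ℓ c' ∈ box ℓ},
        ((‖Φ.ψ X * ((∏ j, c (σ j) (X j a) : ℝ) : ℂ)‖₊ : ℝ≥0∞)) ^ 2 =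
      ∫⁻ X, ((‖Φ.ψ X * ((∏ j, c (σ j) (X j a) : ℝ) : ℂ)‖₊ : ℝ≥0∞)) ^ 2 := by
    intro σ
    refine (lintegral_eq_sum_setLIntegral_fiber hℓ hK σ fun X hX => ?_).symm
    rw [hKℓ] at hX
    rw [Φ.eq_zero X hX, zero_mul]; simp
  simp_rw [hσ]
  rw [sum_lintegral_ennnormSq_loc hc hsq a Φ.contDiff, Φ.norm_eq]

/-- **The floors of the pieces are paid for by the energy.**  For a Dirichlet trial state `Φ` of
`Λ_L`, `L = Kℓ`, a measurable `v ≥ 0` and a profile pair with `∑_b c_b² = 1`, `∑_b c_b c_b' = 0`,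
`∑_b c_b'² ≤ D²`:
`∑_σ ∑_{lam ↦ σ} (E₀^D(#{lam = K³}, L) + ∑_c E₀^Neu(#{lam = c}, ℓ)) · w(σ, lam) ≤ ⟨Φ, HΦ⟩ + N D²`
(`mixed_floor_le_setLIntegral` on each region — `ΦW_σ` is symmetric under the permutations
preserving `lam`, hence `σ`, and vanishes with `Φ` off the box — the partition of the box into the
regions, and the IMS bound). [cite: LSSY2005, (2.52)–(2.53)] -/
theorem sum_sum_floor_mul_weight_le (hℓ : 0 < ℓ) (hK : 0 < K) (hKℓ : (K : ℝ) * ℓ = L)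
    {c : Fin 2 → ℝ → ℝ} (hc : ∀ b, ContDiff ℝ 1 (c b)) (hsq : ∀ t, ∑ b, c b t ^ 2 = 1)
    (horth : ∀ t, ∑ b, c b t * deriv (c b) t = 0) {D : ℝ} (hD : ∀ t, ∑ b, deriv (c b) t ^ 2 ≤ D ^ 2)
    (a : Fin 3) {v : ℝ → ℝ≥0∞} (hv : Measurable v) (Φ : TrialState N L) :
    ∑ σ : Fin N → Fin 2, ∑ lam ∈ Finset.univ.filter
        (fun lam : Fin N → Fin (K ^ 3 + 1) => ∀ j, lam j = Fin.last _ ↔ σ j = 0),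
      (groundStateEnergy v (Finset.univ.filter fun i => lam i = Fin.last _).card L +
          ∑ c' : Fin (K ^ 3), neumannGroundStateEnergy v
            (Finset.univ.filter fun i => lam i = c'.castSucc).card ℓ) *
        ∫⁻ X in {X : Config N | ∀ j (c' : Fin (K ^ 3)), lam j = c'.castSucc →
            X j - cellCorner K ℓ c' ∈ box ℓ},
          ((‖Φ.ψ X * ((∏ j, c (σ j) (X j a) : ℝ) : ℂ)‖₊ : ℝ≥0∞)) ^ 2 ≤
      energy v Φ + N * ENNReal.ofReal (D ^ 2) := by
  -- each region: the mixed floor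
  have hreg : ∀ (σ : Fin N → Fin 2) (lam : Fin N → Fin (K ^ 3 + 1)),
      (∀ j, lam j = Fin.last _ ↔ σ j = 0) →
      (groundStateEnergy v (Finset.univ.filter fun i => lam i = Fin.last _).card L +
          ∑ c' : Fin (K ^ 3), neumannGroundStateEnergy v
            (Finset.univ.filter fun i => lam i = c'.castSucc).card ℓ) *
        ∫⁻ X in {X : Config N | ∀ j (c' : Fin (K ^ 3)), lam j = c'.castSucc →
            X j - cellCorner K ℓ c' ∈ box ℓ},
          ((‖Φ.ψ X * ((∏ j, c (σ j) (X j a) : ℝ) : ℂ)‖₊ : ℝ≥0∞)) ^ 2 ≤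
      ∫⁻ X in {X : Config N | ∀ j (c' : Fin (K ^ 3)), lam j = c'.castSucc →
            X j - cellCorner K ℓ c' ∈ box ℓ},
        kineticDensity (fun X : Config N => Φ.ψ X * ((∏ j, c (σ j) (X j a) : ℝ) : ℂ)) X +
          interaction v X * ((‖Φ.ψ X * ((∏ j, c (σ j) (X j a) : ℝ) : ℂ)‖₊ : ℝ≥0∞)) ^ 2 := by
    intro σ lam hlam
    refine mixed_floor_le_setLIntegral lam (cellCorner K ℓ) ℓ L hv (contDiff_loc hc a σ Φ.contDiff)
      (fun π hπ X => loc_comp_perm c a σ Φ.symm π (fun j => ?_) X) (fun X ⟨j, _, hj⟩ => ?_)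
    · -- a permutation preserving `lam` preserves `σ`
      have h1 := hlam (π j)
      have h2 := hlam j
      rw [hπ j] at h1
      rcases Fin.exists_fin_two.1 ⟨σ j, rfl⟩ with h | h
      · rw [h]; exact (h1.1 (h2.2 h))
      · rcases Fin.exists_fin_two.1 ⟨σ (π j), rfl⟩ with h' | h'
        · exact absurd (h1.2 h') (fun hl => by rw [h2.1 hl] at h; exact absurd h (by decide))
        · rw [h, h']
    · rw [Φ.eq_zero X (fun hX => hj (hX j)), zero_mul]
  -- sum over the regions of a split: the whole energy of the piece
  have hσ : ∀ σ : Fin N → Fin 2, ∑ lam ∈ Finset.univ.filter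
        (fun lam : Fin N → Fin (K ^ 3 + 1) => ∀ j, lam j = Fin.last _ ↔ σ j = 0),
      ∫⁻ X in {X : Config N | ∀ j (c' : Fin (K ^ 3)), lam j = c'.castSucc →
            X j - cellCorner K ℓ c' ∈ box ℓ},
        kineticDensity (fun X : Config N => Φ.ψ X * ((∏ j, c (σ j) (X j a) : ℝ) : ℂ)) X +
          interaction v X * ((‖Φ.ψ X * ((∏ j, c (σ j) (X j a) : ℝ) : ℂ)‖₊ : ℝ≥0∞)) ^ 2 =
      ∫⁻ X, kineticDensity (fun X : Config N => Φ.ψ X * ((∏ j, c (σ j) (X j a) : ℝ) : ℂ)) X +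
          interaction v X * ((‖Φ.ψ X * ((∏ j, c (σ j) (X j a) : ℝ) : ℂ)‖₊ : ℝ≥0∞)) ^ 2 := by
    intro σ
    refine (lintegral_eq_sum_setLIntegral_fiber hℓ hK σ fun X hX => ?_).symm
    rw [hKℓ] at hX
    -- off the box the piece vanishes identically near `X`, so its energy density vanishes
    have hzero : ∀ Y, Y ∉ boxN N L → Φ.ψ Y * ((∏ j, c (σ j) (Y j a) : ℝ) : ℂ) = 0 := fun Y hY => by
      rw [Φ.eq_zero Y hY, zero_mul]
    have hkin : kineticDensity (fun X : Config N => Φ.ψ X * ((∏ j, c (σ j) (X j a) : ℝ) : ℂ)) X = 0 := by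
      unfold kineticDensity
      refine Finset.sum_eq_zero fun i _ => Finset.sum_eq_zero fun k _ => ?_
      rw [fderiv_loc_single hc a σ Φ.contDiff X i k, Φ.fderiv_eq_zero hX, Φ.eq_zero X hX]
      simp
    rw [hkin, hzero X hX]; simp
  calc _ ≤ ∑ σ : Fin N → Fin 2, ∑ lam ∈ Finset.univ.filter
          (fun lam : Fin N → Fin (K ^ 3 + 1) => ∀ j, lam j = Fin.last _ ↔ σ j = 0),
        ∫⁻ X in {X : Config N | ∀ j (c' : Fin (K ^ 3)), lam j = c'.castSucc →
            X j - cellCorner K ℓ c' ∈ box ℓ},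
          kineticDensity (fun X : Config N => Φ.ψ X * ((∏ j, c (σ j) (X j a) : ℝ) : ℂ)) X +
            interaction v X * ((‖Φ.ψ X * ((∏ j, c (σ j) (X j a) : ℝ) : ℂ)‖₊ : ℝ≥0∞)) ^ 2 :=
        Finset.sum_le_sum fun σ _ => Finset.sum_le_sum fun lam hlam =>
          hreg σ lam (Finset.mem_filter.1 hlam).2
    _ = ∑ σ : Fin N → Fin 2,
        ∫⁻ X, kineticDensity (fun X : Config N => Φ.ψ X * ((∏ j, c (σ j) (X j a) : ℝ) : ℂ)) X +
          interaction v X * ((‖Φ.ψ X * ((∏ j, c (σ j) (X j a) : ℝ) : ℂ)‖₊ : ℝ≥0∞)) ^ 2 :=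
        Finset.sum_congr rfl fun σ _ => hσ σ
    _ ≤ (∫⁻ X, kineticDensity Φ.ψ X + interaction v X * ((‖Φ.ψ X‖₊ : ℝ≥0∞)) ^ 2) +
        N * ENNReal.ofReal (D ^ 2) * ∫⁻ X, ((‖Φ.ψ X‖₊ : ℝ≥0∞)) ^ 2 :=
        sum_lintegral_energyDensity_loc_le hc hsq horth hD a hv Φ.contDiff
    _ = energy v Φ + N * ENNReal.ofReal (D ^ 2) := by rw [Φ.norm_eq, mul_one]; rfl

/-- **The slab count through the weights**: for `t₀ ≥ h₀ + δ` (above the ramp),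
`∑ⱼ ∫_{x_{j,a} > t₀} |Φ|² ≤ ∑_σ #{σ = 1} ∑_{lam ↦ σ} w(σ, lam)`. [folklore] -/
theorem slab_le_sum_card_mul_sum_weight (hℓ : 0 < ℓ) (hK : 0 < K) (hKℓ : (K : ℝ) * ℓ = L)
    {c : Fin 2 → ℝ → ℝ} (hc : ∀ b, ContDiff ℝ 1 (c b)) (hsq : ∀ t, ∑ b, c b t ^ 2 = 1)
    {h₀ δ : ℝ} (hc0 : ∀ t, h₀ + δ ≤ t → c 0 t = 0) (a : Fin 3) (Φ : TrialState N L) {t₀ : ℝ}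
    (ht₀ : h₀ + δ ≤ t₀) :
    ∑ j : Fin N, ∫⁻ X in {X : Config N | t₀ < X j a}, ((‖Φ.ψ X‖₊ : ℝ≥0∞)) ^ 2 ≤
      ∑ σ : Fin N → Fin 2, ((Finset.univ.filter fun j => σ j = 1).card : ℝ≥0∞) *
        ∑ lam ∈ Finset.univ.filter
          (fun lam : Fin N → Fin (K ^ 3 + 1) => ∀ j, lam j = Fin.last _ ↔ σ j = 0),
        ∫⁻ X in {X : Config N | ∀ j (c' : Fin (K ^ 3)), lam j = c'.castSucc →
            X j - cellCorner K ℓ c' ∈ box ℓ},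
          ((‖Φ.ψ X * ((∏ j, c (σ j) (X j a) : ℝ) : ℂ)‖₊ : ℝ≥0∞)) ^ 2 := by
  have hσ : ∀ σ : Fin N → Fin 2, ∑ lam ∈ Finset.univ.filter
        (fun lam : Fin N → Fin (K ^ 3 + 1) => ∀ j, lam j = Fin.last _ ↔ σ j = 0),
      ∫⁻ X in {X : Config N | ∀ j (c' : Fin (K ^ 3)), lam j = c'.castSucc →
          X j - cellCorner K ℓ c' ∈ box ℓ},
        ((‖Φ.ψ X * ((∏ j, c (σ j) (X j a) : ℝ) : ℂ)‖₊ : ℝ≥0∞)) ^ 2 =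
      ∫⁻ X, ((‖Φ.ψ X * ((∏ j, c (σ j) (X j a) : ℝ) : ℂ)‖₊ : ℝ≥0∞)) ^ 2 := by
    intro σ
    refine (lintegral_eq_sum_setLIntegral_fiber hℓ hK σ fun X hX => ?_).symm
    rw [hKℓ] at hX
    rw [Φ.eq_zero X hX, zero_mul]; simp
  simp_rw [hσ]
  exact sum_setLIntegral_slab_le_sum_card_mul hc hsq hc0 a Φ.contDiff ht₀

end Weights

/-! ### The upper pieces live in the top layer of cells -/

section TopLayer

variable {N K : ℕ} {ℓ L : ℝ}

/-- The region of a labelling is measurable. [folklore] -/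
theorem measurableSet_region (lam : Fin N → Fin (K ^ 3 + 1)) (ℓ : ℝ) :
    MeasurableSet {X : Config N | ∀ j (c' : Fin (K ^ 3)), lam j = c'.castSucc →
      X j - cellCorner K ℓ c' ∈ box ℓ} := by
  have : {X : Config N | ∀ j (c' : Fin (K ^ 3)), lam j = c'.castSucc →
      X j - cellCorner K ℓ c' ∈ box ℓ} = ⋂ j, ⋂ c' : Fin (K ^ 3), ⋂ (_ : lam j = c'.castSucc),
        (fun X : Config N => X j - cellCorner K ℓ c') ⁻¹' box ℓ := by
    ext X; simp
  rw [this]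
  exact MeasurableSet.iInter fun j => MeasurableSet.iInter fun c' => MeasurableSet.iInter fun _ =>
    (measurableSet_box ℓ).preimage ((measurable_config_apply j).sub_const _)

/-- **A labelling of positive weight puts every upper particle into a cell of the top layer.**
If `c₁ = 0` on `(-∞, L - ℓ]`, `L = Kℓ`, and `∫_{R(lam)} |ΦW_σ|² ≠ 0` for a labelling `lam` inducing
the split `σ`, then every `j` with `σ j = 1` has `lam j = c'` with last coordinate `K - 1` in the
direction `a`. [folklore] -/
theorem topLayer_of_weight_ne_zero (hℓ : 0 < ℓ) (hKℓ : (K : ℝ) * ℓ = L) {c : Fin 2 → ℝ → ℝ}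
    (hc1 : ∀ t, t ≤ L - ℓ → c 1 t = 0) (a : Fin 3) (Φ : Config N → ℂ) {σ : Fin N → Fin 2}
    {lam : Fin N → Fin (K ^ 3 + 1)} (hlam : ∀ j, lam j = Fin.last _ ↔ σ j = 0)
    (hw : ∫⁻ X in {X : Config N | ∀ j (c' : Fin (K ^ 3)), lam j = c'.castSucc →
        X j - cellCorner K ℓ c' ∈ box ℓ}, ((‖Φ X * ((∏ j, c (σ j) (X j a) : ℝ) : ℂ)‖₊ : ℝ≥0∞)) ^ 2 ≠ 0)
    {j : Fin N} (hj : σ j = 1) :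
    ∃ c' : Fin (K ^ 3), lam j = c'.castSucc ∧ (cellCoord K c' a : ℕ) + 1 = K := by
  have hjl : lam j ≠ Fin.last _ := fun h => by
    have := (hlam j).1 h; rw [hj] at this; exact absurd this (by decide)
  obtain ⟨c', hc'⟩ := Fin.exists_castSucc_eq.2 hjl
  refine ⟨c', hc'.symm, ?_⟩
  by_contra hne
  have hlt : (cellCoord K c' a : ℕ) + 1 < K := lt_of_le_of_ne (cellCoord K c' a).is_lt hne
  have hle : ((cellCoord K c' a : ℕ) : ℝ) + 1 ≤ (K : ℝ) - 1 := by
    have : (cellCoord K c' a : ℕ) + 1 + 1 ≤ K := hlt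
    have h' : ((cellCoord K c' a : ℕ) : ℝ) + 1 + 1 ≤ K := by exact_mod_cast this
    linarith
  apply hw
  refine setLIntegral_eq_zero (measurableSet_region lam ℓ) fun X hX => ?_
  have hXj := hX j c' hc'.symm a
  simp only [PiLp.sub_apply, cellCorner_apply, Set.mem_Ioo] at hXj
  have hXa : X j a ≤ L - ℓ := by
    have h1 : X j a < ℓ * ((cellCoord K c' a : ℕ) : ℝ) + ℓ := by linarith [hXj.2]
    have h2 : ℓ * ((cellCoord K c' a : ℕ) : ℝ) + ℓ ≤ ℓ * ((K : ℝ) - 1) := by nlinarith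
    rw [← hKℓ]; nlinarith
  simp only [Pi.zero_apply]
  rw [loc_eq_zero_of_upper_le hc1 a σ Φ hj hXa]
  simp

/-- **The top layer has at most `K²` cells**: the cells with last coordinate `K - 1` in the
direction `a` are determined by their two other coordinates. [folklore] -/
theorem card_topCells_le (K : ℕ) (a : Fin 3) :
    (Finset.univ.filter fun c' : Fin (K ^ 3) => (cellCoord K c' a : ℕ) + 1 = K).card ≤ K ^ 2 := by
  classical
  set f : Fin (K ^ 3) → (Fin 2 → Fin K) := fun c' b => cellCoord K c' (a.succAbove b) with hf
  have hinj : Set.InjOn f (Finset.univ.filter fun c' : Fin (K ^ 3) =>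
      (cellCoord K c' a : ℕ) + 1 = K : Finset (Fin (K ^ 3))) := by
    intro c₁ hc₁ c₂ hc₂ h
    simp only [Finset.coe_filter, Finset.mem_univ, true_and, Set.mem_setOf_eq] at hc₁ hc₂
    apply finFunctionFinEquiv.symm.injective
    funext k
    change cellCoord K c₁ k = cellCoord K c₂ k
    by_cases hk : k = a
    · subst hk; exact Fin.ext (by omega)
    · obtain ⟨b, rfl⟩ := Fin.exists_succAbove_eq hk
      exact congrFun h b
  calc (Finset.univ.filter fun c' : Fin (K ^ 3) => (cellCoord K c' a : ℕ) + 1 = K).card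
      ≤ (Finset.univ : Finset (Fin 2 → Fin K)).card :=
        Finset.card_le_card_of_injOn f (fun _ _ => Finset.mem_univ _) hinj
    _ = K ^ 2 := by simp

/-- **The upper particles are counted by the top cells**: if every `j` with `σ j = 1` sits in a
top cell, then `∑_{c' top} #{lam = c'} = #{σ = 1}`. [folklore] -/
theorem sum_card_topCells_eq_card {σ : Fin N → Fin 2} {lam : Fin N → Fin (K ^ 3 + 1)}
    (hlam : ∀ j, lam j = Fin.last _ ↔ σ j = 0) (a : Fin 3)
    (htop : ∀ j, σ j = 1 → ∃ c' : Fin (K ^ 3), lam j = c'.castSucc ∧ (cellCoord K c' a : ℕ) + 1 = K) :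
    ∑ c' ∈ Finset.univ.filter (fun c' : Fin (K ^ 3) => (cellCoord K c' a : ℕ) + 1 = K),
        (Finset.univ.filter fun i => lam i = c'.castSucc).card =
      (Finset.univ.filter fun j => σ j = 1).card := by
  classical
  symm
  have hmaps : Set.MapsTo (fun j => lam j) (Finset.univ.filter fun j : Fin N => σ j = 1 : Finset (Fin N))
      ((Finset.univ.filter fun c' : Fin (K ^ 3) => (cellCoord K c' a : ℕ) + 1 = K).image
        Fin.castSucc : Finset (Fin (K ^ 3 + 1))) := by
    intro j hj
    simp only [Finset.coe_filter, Finset.mem_univ, true_and, Set.mem_setOf_eq] at hj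
    obtain ⟨c', hc', htc⟩ := htop j hj
    simp only [Finset.coe_image, Finset.coe_filter, Finset.mem_univ, true_and, Set.mem_image,
      Set.mem_setOf_eq]
    exact ⟨c', htc, hc'.symm⟩
  rw [Finset.card_eq_sum_card_fiberwise hmaps, Finset.sum_image fun c₁ _ c₂ _ h =>
    Fin.castSucc_injective _ h]
  refine Finset.sum_congr rfl fun c' _ => ?_
  congr 1
  ext i
  simp only [Finset.mem_filter, Finset.mem_univ, true_and, and_iff_right_iff_imp]
  intro hi
  rcases Fin.exists_fin_two.1 ⟨σ i, rfl⟩ with h | h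
  · exact absurd ((hlam i).2 h) (by rw [hi]; exact (Fin.castSucc_lt_last c').ne)
  · exact h

end TopLayer

end Literature.MathematicalPhysics.QuantumManyBody.BoseGas

end
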